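import Summits.ResolutionOfSingularities.ResolutionOfSingularities.Theorems.CouplingCutClasses
import HarnessLib

/-!
# CouplingCutKernels — decomp-res node «CouplingCut» (lens-4 g18; CRITIC-LEDGER row 117 CLEARED: DECIDED-MOD-PORT +1 cell)
refining the MaxContactCut aside 32260 (host of the lens-4 column).  Tree file 3/4 of the node.

Content VERBATIM from the decomp-res lens-4 cumulative file `HOME/decomp-res-lens-4/g18/CouplingCut.lean` (sha256
5bf7b2ca8f7311e8;
its §1–§6 = g14 HugValuationCut, ALREADY in the tree as `Theorems/HugValuationCut{Chains,Classes,Kernels}` +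
`MaxContactCutHugValuationCut`; §7–§12 = g15 «MarkingBudget» @369c12ac; §13–§17 = g16 «WeightDescent»
@1cb1c32f; §18–§23 = g17
«FactorContact» @daf245ab; §24–§31 = g18 «CouplingCut»).  HOME = run/shared/lean/pub/decomp-res.

Route-independent, cone-free: §29 KERNELS at weight `n` (PROVED) — the commensurable impure cell from the coupling port
(`commensurableImpure_of_port`, `commensurableWildDrifting_of_port`), the exact cut of g17's located residual
(`wildDrifting_iff_cells`,
`impure_iff_comm_incomm`), SMALL WEIGHTS `n ≤ 4` PORT-FREE (`incommensurable_of_le_four`,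
`wildDrifting_of_le_four`, `inLocus_iff_of_le_four`,
`singularSurface_of_le_four`), the in-locus column from the g18 residual and lower weights
(`inLocus_iff_residuals_of_lower_g18`,
`singularSurface_iff_g18`, `ftt_step_of_g18`); §30 `noIncommensurableWildDriftingTowers_iff_five_le` (the residual
is VACUOUS below weight 5).

[WRITER NOTE (decomp-res writer g6): the whole lens-4 chain lives in ONE namespace `…Theorems.HugValuationCut` (the tree's g14
namespace) so that the lens's `HugChain.`/`HugShadow.`/`MarkedShadow.` dot-notation extends the landed structures
verbatim; the lens's
`noTower_iff_perfect_and_imperfect` is the tree's `ContactShadowKernels.noTower_iff_columns`; `set_option` lines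
dropped; cone-free
(no `Theses` import) so the route file can import it for asides; the BY-NAME wiring to the MaxContactCut items is in the
`MaxContactCut<Node>` companion files.]
(Sources: CossartJannsenSaito2020 Key Thm. 6.40, Cor. 6.37, Lem. 6.35/6.36; BierstoneGrigorievMilmanWlodarczyk2011
§3 (marked ideals, Lem. 3.2.1, §3.7); CossartPiltant2019; Abhyankar1956; Cutkosky2009 §2.1; Giraud1975
(Diff-lemma); EGAIV4 §16.8; BierstoneMilman1997; Wlodarczyk2005; Kollar2007 §3 (sums of marked ideals).)
-/

noncomputable section

open CategoryTheory AlgebraicGeometry IsLocalRing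
open Literature.AlgebraicGeometry.Resolution
open Summit.ResolutionOfSingularities.ResolutionOfSingularities.Theorems
open WeakOrderReduction ForcedTowerClasses DivergentTowerClasses MonomialTowerClasses
open HugDimensionClasses HugDimensionKernels SurfaceShadowClasses SurfaceShadowKernels
open ContactShadowClasses (NoTowerImperfect)
open ContactShadowKernels (noTowerImperfect_of_noTower noTowerImperfect_mono noTower_iff_columns)
open NearPointCut (SingularClass singularSurface_iff_noTower)
open AbsoluteContactClasses (IsAbsContactAt)

namespace Summit.ResolutionOfSingularities.ResolutionOfSingularities.Theorems.HugValuationCut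

variable {K : Type} [Field K]

/-! ## §29 (g18 · NEW) Kernels at weight `n` (PROVED) -/

/-- **KERNEL — THE COMMENSURABLE IMPURE CELL IS EMPTY modulo the coupling port and the LOWER WEIGHTS** (the coupled
re-marking is a tower of weight `max(ν, n − ν) < n`). [folklore] -/
theorem commensurableImpure_of_port {n : ℕ} (hCo : CouplingPort n)
    (hlow : ∀ n' : ℕ, 1 ≤ n' → n' < n → ForcedTowersTerminate n') : CommensurableImpureTowersTerminate n := by
  intro p hp k _ _ T g hB hD hE hT
  obtain ⟨hS, hL, S, hP, hnp, hco⟩ := hT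
  obtain ⟨n', h1, h2, T', g', hB', hD', hE'⟩ := hCo p hp k T g hB hD hE hS S (hL.2 S) hP hnp hco
  exact hlow n' h1 h2 p hp k T' g' hB' hD' hE'

/-- **KERNEL — THE EXACT COMMENSURABILITY CUT of g17's located residual, PORT-FREE, pure logic**:
`(L,P,drift,wild) ⟺ (L,P,drift,wild,comm) ∧ (L,P,drift,wild,incomm)`. [folklore] -/
theorem wildDrifting_iff_cells {n : ℕ} :
    WildDriftingTowersTerminate n ↔
      CommensurableWildDriftingTowersTerminate n ∧ IncommensurableWildDriftingTowersTerminate n := by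
  refine ⟨fun h => ⟨noTower_mono (fun _ h' => ?_) h, noTower_mono (fun _ h' => ?_) h⟩, ?_⟩
  · obtain ⟨hS, hL, S, hP, hnp, hD, hW, -⟩ := h'
    exact ⟨hS, hL, S, hP, hnp, hD, hW⟩
  · obtain ⟨hS, hL, S, hP, hnp, hD, hW, -⟩ := h'
    exact ⟨hS, hL, S, hP, hnp, hD, hW⟩
  · rintro ⟨h₁, h₂⟩ p hp k _ _ T g hB hD hE ⟨hS, hL, S, hP, hnp, hDr, hW⟩
    rcases S.commensurable_or_incommensurable n with hc | hi
    · exact h₁ p hp k T g hB hD hE ⟨hS, hL, S, hP, hnp, hDr, hW, hc⟩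
    · exact h₂ p hp k T g hB hD hE ⟨hS, hL, S, hP, hnp, hDr, hW, hi⟩

/-- the whole impure principal column is exactly its commensurable and incommensurable slabs (pure logic). [folklore] -/
theorem impure_iff_comm_incomm {n : ℕ} :
    (NoTower n fun T => SingularClass T ∧ InLocusShadow T ∧ ∃ S : HugShadow T, S.Principal ∧ ¬ S.Pure n) ↔
      CommensurableImpureTowersTerminate n ∧ IncommensurableImpureTowersTerminate n := by
  refine ⟨fun h => ⟨noTower_mono (fun _ h' => ?_) h, noTower_mono (fun _ h' => ?_) h⟩, ?_⟩
  · obtain ⟨hS, hL, S, hP, hnp, -⟩ := h'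
    exact ⟨hS, hL, S, hP, hnp⟩
  · obtain ⟨hS, hL, S, hP, hnp, -⟩ := h'
    exact ⟨hS, hL, S, hP, hnp⟩
  · rintro ⟨h₁, h₂⟩ p hp k _ _ T g hB hD hE ⟨hS, hL, S, hP, hnp⟩
    rcases S.commensurable_or_incommensurable n with hc | hi
    · exact h₁ p hp k T g hB hD hE ⟨hS, hL, S, hP, hnp, hc⟩
    · exact h₂ p hp k T g hB hD hE ⟨hS, hL, S, hP, hnp, hi⟩

/-- **KERNEL — THE COMMENSURABLE WILD DRIFTING CELL IS EMPTY modulo the port and the lower weights.** [folklore] -/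
theorem commensurableWildDrifting_of_port {n : ℕ} (hCo : CouplingPort n)
    (hlow : ∀ n' : ℕ, 1 ≤ n' → n' < n → ForcedTowersTerminate n') : CommensurableWildDriftingTowersTerminate n :=
  noTower_mono (fun _ ⟨hS, hL, S, hP, hnp, _, _, hc⟩ => ⟨hS, hL, S, hP, hnp, hc⟩) (commensurableImpure_of_port hCo hlow)

/-- **KERNEL — g17's located residual (L,P,drift,wild) from the port, the lower weights and the INCOMMENSURABLE residual
alone.** [folklore] -/
theorem wildDrifting_of_g18 {n : ℕ} (hCo : CouplingPort n)
    (hlow : ∀ n' : ℕ, 1 ≤ n' → n' < n → ForcedTowersTerminate n') (hR : IncommensurableWildDriftingTowersTerminate n) :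
    WildDriftingTowersTerminate n :=
  wildDrifting_iff_cells.mpr ⟨commensurableWildDrifting_of_port hCo hlow, hR⟩

/-- Necessity, PORT-FREE: g17's residual implies the g18 residual. [folklore] -/
theorem incommensurableWildDrifting_of_wildDrifting {n : ℕ} (h : WildDriftingTowersTerminate n) :
    IncommensurableWildDriftingTowersTerminate n :=
  (wildDrifting_iff_cells.mp h).2

/-- **EXACT RE-LOCATION modulo the port below a terminating range: (L,P,drift,wild) ⟺ (L,P,drift,wild,incomm).** [folklore] -/
theorem wildDrifting_iff_incommensurable_of_port {n : ℕ} (hCo : CouplingPort n)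
    (hlow : ∀ n' : ℕ, 1 ≤ n' → n' < n → ForcedTowersTerminate n') :
    WildDriftingTowersTerminate n ↔ IncommensurableWildDriftingTowersTerminate n :=
  ⟨incommensurableWildDrifting_of_wildDrifting, wildDrifting_of_g18 hCo hlow⟩

/-- **NO INCOMMENSURABLE SHADOW BELOW WEIGHT FIVE (PROVED, port-free, no lower weights).** [folklore] -/
theorem incommensurable_of_le_four {n : ℕ} (hn : n ≤ 4) : NoTower n fun T => ∃ S : HugShadow T, S.Incommensurable n := by
  intro p hp k _ _ T g hB hD hE ⟨S, hi⟩
  have := hi.five_le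
  omega

/-- **THE LOCATED RESIDUAL IS EMPTY AT EVERY WEIGHT `n ≤ 4` (PROVED, port-free)** — in particular at the minimal
bi-wild weight `n = 4 = 2p` of characteristic `2` (the census bed T-IBW). [folklore] -/
theorem incommensurableWildDrifting_of_le_four {n : ℕ} (hn : n ≤ 4) : IncommensurableWildDriftingTowersTerminate n :=
  noTower_mono (fun _ ⟨_, _, S, _, _, _, _, hi⟩ => ⟨S, hi⟩) (incommensurable_of_le_four hn)

/-- **g17's located residual IS DECIDED AT WEIGHTS `≤ 4` modulo the coupling port and the lower weights.** [folklore] -/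
theorem wildDrifting_of_le_four {n : ℕ} (hCo : CouplingPort n)
    (hlow : ∀ n' : ℕ, 1 ≤ n' → n' < n → ForcedTowersTerminate n') (hn : n ≤ 4) : WildDriftingTowersTerminate n :=
  wildDrifting_of_g18 hCo hlow (incommensurableWildDrifting_of_le_four hn)

/-- **THE MINIMAL-WEIGHT NORMAL FORM, g18** (modulo the three COSTUME ports of the impure column): below a weight at which
all lower forced towers terminate, the in-locus column is EXACTLY `(L,¬P) ∧ (L,P,pure) ∧
(L,P,drift,wild,INCOMMENSURABLE)` —
a minimal-weight in-locus counterexample hugs a codimension-two surface, or is PURE, or is an INCOMMENSURABLE BI-WILD DRIFT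
(`ν ∤ n − ν`, `n − ν ∤ ν`, `n ≥ 5`). [folklore] -/
theorem inLocus_iff_residuals_of_lower_g18 {n : ℕ} (hDesc : DescentPort n) (hFC : FactorContactPort n)
    (hCo : CouplingPort n) (hlow : ∀ n' : ℕ, 1 ≤ n' → n' < n → ForcedTowersTerminate n') :
    InLocusShadowTowersTerminate n ↔ NonPrincipalInLocusTowersTerminate n ∧ PurePrincipalTowersTerminate n ∧
      IncommensurableWildDriftingTowersTerminate n :=
  (inLocus_iff_residuals_of_lower hDesc hlow).trans
    ⟨fun h => ⟨h.1, h.2.1, incommensurableWildDrifting_of_wildDrifting (wildDrifting_of_drifting h.2.2)⟩,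
      fun h => ⟨h.1, h.2.1, drifting_of_g17 hFC (wildDrifting_of_g18 hCo hlow h.2.2)⟩⟩

/-- at a minimal weight `n ≤ 4` the in-locus column is exactly `(L,¬P) ∧ (L,P,pure)` (the residual vanishes). [folklore] -/
theorem inLocus_iff_of_le_four {n : ℕ} (hDesc : DescentPort n) (hFC : FactorContactPort n) (hCo : CouplingPort n)
    (hlow : ∀ n' : ℕ, 1 ≤ n' → n' < n → ForcedTowersTerminate n') (hn : n ≤ 4) :
    InLocusShadowTowersTerminate n ↔ NonPrincipalInLocusTowersTerminate n ∧ PurePrincipalTowersTerminate n :=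
  (inLocus_iff_residuals_of_lower_g18 hDesc hFC hCo hlow).trans
    ⟨fun h => ⟨h.1, h.2.1⟩, fun h => ⟨h.1, h.2, incommensurableWildDrifting_of_le_four hn⟩⟩

/-- Necessity at the target, PORT-FREE: 32260 at weight `n` implies the g18 residual. [folklore] -/
theorem incommensurableWildDrifting_of_singularSurface {n : ℕ} (h : SingularSurfaceHuggingTowersTerminate n) :
    IncommensurableWildDriftingTowersTerminate n :=
  incommensurableWildDrifting_of_wildDrifting (wildDrifting_of_singularSurface h)

/-- **KERNEL — THE TARGET LEAF 32260 at weight `n`** from g15's (O), g16's (L,¬P) and (L,P,pure), the g18 INCOMMENSURABLE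
residual, the five COSTUME ports and the lower weights. [folklore] -/
theorem singularSurface_of_g18 {n : ℕ} (hP : ShadowPort n) (hM : MarkingPort n) (hDesc : DescentPort n)
    (hFC : FactorContactPort n) (hCo : CouplingPort n) (hlow : ∀ n' : ℕ, 1 ≤ n' → n' < n → ForcedTowersTerminate n')
    (hO : OffLocusShadowTowersTerminate n) (hNP : NonPrincipalInLocusTowersTerminate n)
    (hPu : PurePrincipalTowersTerminate n) (hR : IncommensurableWildDriftingTowersTerminate n) :
    SingularSurfaceHuggingTowersTerminate n :=
  singularSurface_of_g17 hP hM hDesc hFC hlow hO hNP hPu (wildDrifting_of_g18 hCo hlow hR)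

/-- **EXACT at weight `n` below a terminating range** (ports + lower weights): 32260 at `n` ⟺ (O) ∧ (L,¬P) ∧
(L,P,pure) ∧
(L,P,drift,wild,INCOMM). [folklore] -/
theorem singularSurface_iff_g18 {n : ℕ} (hP : ShadowPort n) (hM : MarkingPort n) (hDesc : DescentPort n)
    (hFC : FactorContactPort n) (hCo : CouplingPort n) (hlow : ∀ n' : ℕ, 1 ≤ n' → n' < n → ForcedTowersTerminate n') :
    SingularSurfaceHuggingTowersTerminate n ↔ OffLocusShadowTowersTerminate n ∧
      NonPrincipalInLocusTowersTerminate n ∧ PurePrincipalTowersTerminate n ∧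
        IncommensurableWildDriftingTowersTerminate n :=
  (singularSurface_iff_g17 hP hM hDesc hFC hlow).trans
    ⟨fun h => ⟨h.1, h.2.1, h.2.2.1, incommensurableWildDrifting_of_wildDrifting h.2.2.2⟩,
      fun h => ⟨h.1, h.2.1, h.2.2.1, wildDrifting_of_g18 hCo hlow h.2.2.2⟩⟩

/-- at weights `n ≤ 4` the target leaf needs NO drifting residual at all (ports + lower weights). [folklore] -/
theorem singularSurface_of_le_four {n : ℕ} (hP : ShadowPort n) (hM : MarkingPort n) (hDesc : DescentPort n)
    (hFC : FactorContactPort n) (hCo : CouplingPort n) (hlow : ∀ n' : ℕ, 1 ≤ n' → n' < n → ForcedTowersTerminate n')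
    (hO : OffLocusShadowTowersTerminate n) (hNP : NonPrincipalInLocusTowersTerminate n)
    (hPu : PurePrincipalTowersTerminate n) (hn : n ≤ 4) : SingularSurfaceHuggingTowersTerminate n :=
  singularSurface_of_g18 hP hM hDesc hFC hCo hlow hO hNP hPu (incommensurableWildDrifting_of_le_four hn)

/-- **KERNEL — the ROOT PIECE at weight `n`** from the leaves at weight `n` and all lower weights (the step of the strong
induction; g17's step with the wild cell replaced by coupling port + incommensurable residual). [folklore] -/
theorem ftt_step_of_g18 {n : ℕ} (hn : 1 ≤ n) (hMo : MonomialCorner n) (hC : CurveLaw n) (hSL : SurfaceLaw n)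
    (hH : HypersurfaceHuggingTowersTerminate n) (hP : ShadowPort n) (hM : MarkingPort n) (hDesc : DescentPort n)
    (hFC : FactorContactPort n) (hCo : CouplingPort n) (hO : OffLocusShadowTowersTerminate n)
    (hNP : NonPrincipalInLocusTowersTerminate n) (hPu : PurePrincipalTowersTerminate n)
    (hR : IncommensurableWildDriftingTowersTerminate n)
    (hlow : ∀ n' : ℕ, 1 ≤ n' → n' < n → ForcedTowersTerminate n') : ForcedTowersTerminate n :=
  ftt_step_of_g17 hn hMo hC hSL hH hP hM hDesc hFC hO hNP hPu (wildDrifting_of_g18 hCo hlow hR) hlow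

/-! ## §30 (g18) port-free all-weights kernel -/

/-- **THE RESIDUAL LIVES AT WEIGHTS `≥ 5` ONLY (PROVED).** [folklore] -/
theorem noIncommensurableWildDriftingTowers_iff_five_le :
    NoIncommensurableWildDriftingTowers ↔ ∀ n : ℕ, 5 ≤ n → IncommensurableWildDriftingTowersTerminate n :=
  ⟨fun h n hn => h n (by omega), fun h n _ =>
    (Nat.lt_or_ge n 5).elim (fun h4 => incommensurableWildDrifting_of_le_four (by omega)) (h n)⟩

end Summit.ResolutionOfSingularities.ResolutionOfSingularities.Theorems.HugValuationCut
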